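/-
Copyright (c) 2026 the pub-hodgecm-mathlib formalisation cell (harness21).  Prover seat hodgecm-mathlib-K2E4-p14 (g2),
Track B «K2-LIT» ∕ h413, ENGINE E4 unit U6 `ArchLimitConstant` — the (end-alg) brick of the G′ package of socket #9 WITH THE PHASE OF ITS END CONSTANT
(`GPrimeDataSigned.lam_phase`, ★ p855382; dealer K2E4-plan (g0) deal (c) 2026-09-03T23:15:03Z).  2026-09-03.
-/
import Summits.HodgeConjecture.HodgeConjecture.Theorems.K2E4ArchGPrimeEndAlg    -- ★ p855388 (K2E4-p13): the UNSIGNED (end-alg) `exists_gState_univ_eq_of_wallIntegral`, `hPoint_univ_eq_cayley`, `relabelMultiplicity_ne_zero`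
import Summits.HodgeConjecture.HodgeConjecture.Theorems.K2E4ArchGPrimeLemmas    -- ★ p855296 (K2E4-p11): `twoBlock_univ`, `stateMeasure_univ`, `datum_univ`
import HarnessLib

/-!
# K2 · E4 · U6, brick (end-alg) SIGNED: the fully descended `G′`-state is `lam · Φ^{st}_∞(t z⁰, Θ∘coe)` with the PHASE LAW `lam = s · Π_w sgn σ_w(α₀α₂) · T′.Δ(h₀, t)`, `s > 0`
# (Rogawski 1990 §8.2 Prop. 8.2.1 proof p. 119 «the constant in the limit formula for H′ differs by a sign from that in the limit formula for H»; Lemma 14.5.2 (b) p. 238)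

Cell `pub/hodgecm-mathlib` (D-0151), HCML Track B, crux H413 = `stmt-HodgeConjecture-24833`; prover seat `hodgecm-mathlib-K2E4-p14` (g2), dealt (c) by K2E4-plan (g0) 23:15:03Z.
Socket #9 `sig_K2E4ExplicitArchSingularTransfer` (assembler K2E4-p09 ★ p855083) has the VALUE `c_∞ = κ·(Π_w C_w)·2^{|W|} ∕ lam` with `lam = GPrimeData.lam` the end constant of
the `G′` package (K2E4-p11∕p13: ★ Defs p855236 · Lemmas p855296 · Reg · Pins · Step · EndAlg p855388 · EndRead p855485 · End p855509); socket #10♯ (K2E4-p15 ★ p855349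
`explicitArchConstantPhaseSigned_of_signLaw`) needs its PHASE.  ★ (end-alg) already constructs `lam` EXPLICITLY —
`lam = χ·N⁻¹·(cT·Π_v Laurent_v(z⁰_v))·(Π_v η_v)·r·Π_v (2·p_v!(3−p_v)!·Π_i sgn re σ_v α_i)` — but exports only `lam ≠ 0`.  THIS FILE re-runs that construction with the reading
constant `r` REAL POSITIVE (★ `K2E4ArchGPrimeEndReadSigned`) and exports K2E4-p15's law (bytes of the field `GPrimeDataSigned.lam_phase`, ★ p855382, VERBATIM):
`∃ s : ℝ, 0 < s ∧ lam = s · (Π_w sgn Re σ_w(α 0 · α 2)) · T′.Δ(h₀, t)`, `t = t(σe₁, σe₂, σe₁)` the wall torus point, `h₀ = (Ψ_{Q₂}⁻¹ t₂(σe₁, σe₁), diag σe₂)` the `H_∞`-point at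
the central 2-block datum.

THE MATHEMATICS.  By ★ (end-alg) §1 `hPoint_univ_eq_cayley` (with ★ `twoBlock_univ`) `h₀` IS the Cayley point `γ_H(z⁰)`, and `t = t(z⁰ ∘ id)`; so ★ G2
`archTransferFactor_cayleyTorus_relabel_eq_sign_mul` (K2E4-p11 p854926) at the identity relabelling reads `T′.Δ(h₀, t) = (Π_v sgn re σ_v α₁ · η_v) · cT · Π_v Laurent_v(z⁰_v)`.
Dividing, `lam ∕ T′.Δ(h₀, t) = χ·N⁻¹·r·Π_v 2·p_v!(3−p_v)! · Π_v (sgn σ_v α₀ · sgn σ_v α₁ · sgn σ_v α₂)·η_v ∕ (sgn σ_v α₁ · η_v) = s · Π_v sgn σ_v α₀ · sgn σ_v α₂` with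
`s := χ.toReal·N⁻¹·r·Π_v 2·p_v!(3−p_v)! > 0` (`χ ≠ 0, ∞`, `N ≥ 1`, `r > 0`), and `sgn σ_v α₀ · sgn σ_v α₂ = sgn re σ_v(α₀α₂)` because every `σ_v α_i` is real (`hherm`).  So the
phase of the end constant relative to the transfer factor at the semiregular pair is the product over the complex places of the sign of `σ_v(α₀α₂)` — the sign of the
DISCRIMINANT DIRECTION of the wall 2-block `⟨α₀, α₂⟩`: `+` where `W₂ ⊗_v ℂ` is definite (compact wall), `−` where it is `(1,1)` (non-compact wall), print's «differs by a sign».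

* **`exists_gState_univ_eq_of_wallIntegral_signed`** — ★ (end-alg)'s statement with `(r : ℝ) (hr : 0 < r)` and `lam ≠ 0` replaced by the phase law; proof = ★ p855388's
  (κ-signed regrouping ★ (E-alg), Cayley-family factor ★ G2) plus the division above.  THEOREMS ONLY (no `def`, no `instance`, no notation, no `sorry`); lane
  `--supports stmt-HodgeConjecture-24833 --as helper`.
HONEST LABEL: HC_CM is proved only modulo the 7 printed citations (2 remaining named inputs: hLiu418 = stmt-HodgeConjecture-24832, h413 = stmt-HodgeConjecture-24833) until rung 0 closes; this
file is algebra over ★ bricks and pays no socket by itself ((end) SIGNED = this ∘ ★ `K2E4ArchGPrimeEndReadSigned`, file `K2E4ArchGPrimeEndSigned`; then K2E4-p09's signed packer → #10♯).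

## References
* [Rogawski1990] J. D. Rogawski, *Automorphic Representations of Unitary Groups in Three Variables*, Ann. of Math. Stud. 123 (1990), §8.2 Prop. 8.2.1 (a) p. 118, proof pp. 118–119
  (held e-text book:rogawski1990 p0118.txt:L32 «differs by a sign»), p. 124; §14.5 Lemma 14.5.2 (b) pp. 238–239; §14.6 p. 242; §4.1 (4.1.2) p. 39.
-/

set_option autoImplicit false
set_option linter.dupNamespace false  -- the cell's namespace convention `Summit.HodgeConjecture.HodgeConjecture.Cruxes.H413.<File>` repeats the summit = problem name

noncomputable section

open MeasureTheory Measure Filter Topology NumberField NumberField.InfinitePlace NumberField.mixedEmbedding Equiv Function Set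
open Literature.MeasureTheory.Group Literature.NumberTheory.Automorphic Literature.NumberTheory.Automorphic.UnitaryGroup
open Literature.LinearAlgebra.Matrix Literature.NumberTheory.Rogawski1990 Literature.NumberTheory.GaloisRepresentations
open Summit.HodgeConjecture.HodgeConjecture.Cruxes.H413.K2E4ArchGPrimeDefs Summit.HodgeConjecture.HodgeConjecture.Cruxes.H413.K2E4ArchWallDeltaFactor
open scoped Matrix MatrixGroups Matrix.Norms.Operator ContDiff ENNReal Classical

namespace Summit.HodgeConjecture.HodgeConjecture.Cruxes.H413.K2E4ArchGPrimeEndAlgSigned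

variable (L : Type) [Field L] [NumberField L] [IsCMField L] (α : Fin 3 → L)

section Frame

variable [MeasurableSpace (GL (Fin 3) ℂ)] [BorelSpace (GL (Fin 3) ℂ)]
  (νw : ∀ v : {w : InfinitePlace L // IsComplex w}, Measure (archLocal L 3 (Matrix.diagonal α) v)) (hνw : ∀ v, (νw v).IsHaarMeasure ∧ (νw v).IsMulRightInvariant)
  (e₁ e₂ : L) (h₁ : (IsCMField.complexConj L e₁ : L) * e₁ = 1) (h₂ : (IsCMField.complexConj L e₂ : L) * e₂ = 1) (hne : e₁ ≠ e₂)
  [∀ (w : {w : InfinitePlace L // IsComplex w}) (τ : Perm (Fin 3)), MeasurableSpace (archLocal L 3 (Matrix.diagonal (α ∘ ⇑τ)) w ⧸ Subgroup.centralizer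
    ({(⟨circleDiagonal 3 (wallPoint L e₁ e₂ h₁ h₂ w), circleDiagonal_mem_archLocal_diagonal L 3 (α ∘ ⇑τ) w (wallPoint L e₁ e₂ h₁ h₂ w)⟩ : archLocal L 3 (Matrix.diagonal (α ∘ ⇑τ)) w)} :
      Set (archLocal L 3 (Matrix.diagonal (α ∘ ⇑τ)) w)))]
  [∀ (w : {w : InfinitePlace L // IsComplex w}) (τ : Perm (Fin 3)), BorelSpace (archLocal L 3 (Matrix.diagonal (α ∘ ⇑τ)) w ⧸ Subgroup.centralizer
    ({(⟨circleDiagonal 3 (wallPoint L e₁ e₂ h₁ h₂ w), circleDiagonal_mem_archLocal_diagonal L 3 (α ∘ ⇑τ) w (wallPoint L e₁ e₂ h₁ h₂ w)⟩ : archLocal L 3 (Matrix.diagonal (α ∘ ⇑τ)) w)} :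
      Set (archLocal L 3 (Matrix.diagonal (α ∘ ⇑τ)) w)))]
  (νH : ∀ (w : {w : InfinitePlace L // IsComplex w}) (τ : Perm (Fin 3)), Measure (Subgroup.centralizer
    ({(⟨circleDiagonal 3 (wallPoint L e₁ e₂ h₁ h₂ w), circleDiagonal_mem_archLocal_diagonal L 3 (α ∘ ⇑τ) w (wallPoint L e₁ e₂ h₁ h₂ w)⟩ : archLocal L 3 (Matrix.diagonal (α ∘ ⇑τ)) w)} :
      Set (archLocal L 3 (Matrix.diagonal (α ∘ ⇑τ)) w))))
  (hνH : ∀ w τ, (νH w τ).IsHaarMeasure ∧ (νH w τ).IsInvInvariant)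


variable [MeasurableSpace (arch (↥(maximalRealSubfield L)) L (IsCMField.complexConj L) 3 (Matrix.diagonal α))]
  [BorelSpace (arch (↥(maximalRealSubfield L)) L (IsCMField.complexConj L) 3 (Matrix.diagonal α))]
  [∀ γ : arch (↥(maximalRealSubfield L)) L (IsCMField.complexConj L) 3 (Matrix.diagonal α), MeasurableSpace (arch (↥(maximalRealSubfield L)) L (IsCMField.complexConj L) 3 (Matrix.diagonal α) ⧸ Subgroup.centralizer ({γ} : Set (arch (↥(maximalRealSubfield L)) L (IsCMField.complexConj L) 3 (Matrix.diagonal α))))]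
  [∀ γ : arch (↥(maximalRealSubfield L)) L (IsCMField.complexConj L) 3 (Matrix.diagonal α), BorelSpace (arch (↥(maximalRealSubfield L)) L (IsCMField.complexConj L) 3 (Matrix.diagonal α) ⧸ Subgroup.centralizer ({γ} : Set (arch (↥(maximalRealSubfield L)) L (IsCMField.complexConj L) 3 (Matrix.diagonal α))))]
  (ν : Measure (arch (↥(maximalRealSubfield L)) L (IsCMField.complexConj L) 3 (Matrix.diagonal α))) [IsFiniteMeasureOnCompacts ν] [ν.IsMulRightInvariant]
  (χ : ℝ≥0∞)
  (T' : ArchTransferFactor L (Matrix.diagonal α)) (μω : HeckeCharacter L)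
  (hμω : ∀ x : ideleGroup ↥(maximalRealSubfield L), μω (AdeleRing.ideleBaseChange (↥(maximalRealSubfield L)) L x) = quadraticHeckeCharCM L x)
  (cT : ℂ) (hT : ∀ a b, T'.Δ a b = cT * archExplicitDelta L (Matrix.diagonal α) a μω b)

include hμω hT in
/-- **(end-alg), SIGNED — THE FULLY DESCENDED `G′`-STATE IS `lam · Φ^{st}_∞` WITH THE PHASE LAW OF `lam`.**  Hypotheses: ★ (end-alg)'s (`hα`, `hherm`, `χ ≠ 0, ∞`, `cT ≠ 0`) and
the wall-integral reading with a REAL constant `r > 0` (★ `K2E4ArchGPrimeEndReadSigned.exists_wallIntegral_eq_mul_classOrbitalIntegral_pos`).  Conclusion: ONE `lam ≠ 0` with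
(i) the phase law `∃ s > 0, lam = s · (Π_w sgn Re σ_w(α 0 · α 2)) · T′.Δ(h₀, t)` — the bytes of `GPrimeDataSigned.lam_phase` (★ p855382) — and (ii) ★ (end-alg)'s identity
`gState … T′ χ Θ univ u = lam · Φ^{st}_∞(t z⁰, Θ∘coe; archSingularTopFormFamily ν)` for every continuous compactly supported `Θ` and every `u`.
[cite: Rogawski1990, §8.2 Prop. 8.2.1 (a) p. 118, proof p. 119, p. 124; §14.5 Lemma 14.5.2 (b) pp. 238–239; §14.6 p. 242] -/
theorem exists_gState_univ_eq_of_wallIntegral_signed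
    (hα : ∀ i, α i ≠ 0) (hherm : ∀ i, (IsCMField.complexConj L (α i) : L) = α i) (hχ0 : χ ≠ 0) (hχ : χ ≠ ⊤) (hcT : cT ≠ 0)
    (r : ℝ) (hr : 0 < r)
    (hread : ∀ (Θ : Matrix (Fin 3) (Fin 3) (mixedSpace L) → ℂ), Continuous Θ →
      HasCompactSupport (fun g : arch (↥(maximalRealSubfield L)) L (IsCMField.complexConj L) 3 (Matrix.diagonal α) => Θ ((g : GL (Fin 3) (mixedSpace L)) : Matrix (Fin 3) (Fin 3) (mixedSpace L))) →
      ∀ ρ : {w : InfinitePlace L // IsComplex w} → Perm (Fin 3),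
        ∫ o, Θ ((((archPiEquivCM 3 L (Matrix.diagonal α)).symm o : arch (↥(maximalRealSubfield L)) L (IsCMField.complexConj L) 3 (Matrix.diagonal α)) :
            GL (Fin 3) (mixedSpace L)) : Matrix (Fin 3) (Fin 3) (mixedSpace L))
          ∂(Measure.pi fun v => wallMeasure L α νw hνw e₁ e₂ h₁ h₂ hne νH hνH v (ρ v)) =
        (r : ℂ) * classOrbitalIntegral (Literature.NumberTheory.Weil1964.UnitaryArchTopForm.archSingularTopFormFamily L (Matrix.diagonal α) ν)
          (fun g : arch (↥(maximalRealSubfield L)) L (IsCMField.complexConj L) 3 (Matrix.diagonal α) => Θ ((g : GL (Fin 3) (mixedSpace L)) : Matrix (Fin 3) (Fin 3) (mixedSpace L)))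
          (ConjClasses.mk (archDiagTorus L 3 α fun v => wallPoint L e₁ e₂ h₁ h₂ v ∘ ⇑(ρ v)))) :
    ∃ lam : ℂ, lam ≠ 0 ∧ (∃ s : ℝ, 0 < s ∧
            lam = (s : ℂ) * ((∏ w : {w : InfinitePlace L // IsComplex w}, (SignType.sign ((w.1.embedding (α 0 * α 2)).re) : ℤ)) : ℂ) *
              T'.Δ ((unitaryGroupOfFormCongrOfEq (UnitaryGroup.conjMixed (↥(maximalRealSubfield L)) L (IsCMField.complexConj L))
                      (Matrix.GeneralLinearGroup.map (mixedEmbedding L) (Matrix.GeneralLinearGroup.mkOfDetNeZero !![(1 : L), 1; 1, -1] (UnitaryGroup.det_quasiSplitFrameTwo_ne_zero L)))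
                      (UnitaryGroup.archFormOf L 2 (Matrix.diagonal ![(2 : L)⁻¹, -(2 : L)⁻¹])) (UnitaryGroup.archFormOf L 2 (Matrix.of fun i j : Fin 2 => if i.val + j.val + 1 = 2 then (1 : L) else 0))
                      (UnitaryGroup.formCongr_map_mixedEmbedding_archFormOf_eq L (UnitaryGroup.formCongr_quasiSplitFrameTwo_diagonal L))).symm
                      (UnitaryGroup.archDiagTorus L 2 ![(2 : L)⁻¹, -(2 : L)⁻¹] fun w => ![(⟨w.1.embedding e₁, mem_sphere_zero_iff_norm.mpr (UnitaryGroup.norm_embedding_eq_one_of_complexConj_mul_self L e₁ h₁ w)⟩ : Circle), ⟨w.1.embedding e₁, mem_sphere_zero_iff_norm.mpr (UnitaryGroup.norm_embedding_eq_one_of_complexConj_mul_self L e₁ h₁ w)⟩]),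
                    (UnitaryGroup.archPiEquivCM 1 L (Matrix.of fun i j : Fin 1 => if i.val + j.val + 1 = 1 then (1 : L) else 0)).symm fun w =>
                      ⟨UnitaryGroup.circleDiagonal 1 ![(⟨w.1.embedding e₂, mem_sphere_zero_iff_norm.mpr (UnitaryGroup.norm_embedding_eq_one_of_complexConj_mul_self L e₂ h₂ w)⟩ : Circle)], UnitaryGroup.circleDiagonal_mem_archLocal_antidiagOne L w _⟩)
                (UnitaryGroup.archDiagTorus L 3 α fun w => ![(⟨w.1.embedding e₁, mem_sphere_zero_iff_norm.mpr (UnitaryGroup.norm_embedding_eq_one_of_complexConj_mul_self L e₁ h₁ w)⟩ : Circle), ⟨w.1.embedding e₂, mem_sphere_zero_iff_norm.mpr (UnitaryGroup.norm_embedding_eq_one_of_complexConj_mul_self L e₂ h₂ w)⟩, ⟨w.1.embedding e₁, mem_sphere_zero_iff_norm.mpr (UnitaryGroup.norm_embedding_eq_one_of_complexConj_mul_self L e₁ h₁ w)⟩])) ∧ ∀ (Θ : Matrix (Fin 3) (Fin 3) (mixedSpace L) → ℂ), Continuous Θ →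
      HasCompactSupport (fun g : arch (↥(maximalRealSubfield L)) L (IsCMField.complexConj L) 3 (Matrix.diagonal α) => Θ ((g : GL (Fin 3) (mixedSpace L)) : Matrix (Fin 3) (Fin 3) (mixedSpace L))) →
      ∀ u : {w : InfinitePlace L // IsComplex w} → Fin 2 → Circle,
        gState L α νw hνw e₁ e₂ h₁ h₂ hne νH hνH T' χ Θ Finset.univ u =
          lam * archStableOrbitalIntegral L 3 (Matrix.diagonal α) (Literature.NumberTheory.Weil1964.UnitaryArchTopForm.archSingularTopFormFamily L (Matrix.diagonal α) ν)
            (fun g : arch (↥(maximalRealSubfield L)) L (IsCMField.complexConj L) 3 (Matrix.diagonal α) => Θ ((g : GL (Fin 3) (mixedSpace L)) : Matrix (Fin 3) (Fin 3) (mixedSpace L)))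
            (archDiagTorus L 3 α (wallPoint L e₁ e₂ h₁ h₂)) := by
  have hreal : ∀ (v : {w : InfinitePlace L // IsComplex w}) (i : Fin 3), (v.1.embedding (α i)).im = 0 :=
    fun v i => im_embedding_eq_zero_of_complexConj_eq L v (hherm i)
  -- ★ (Δ-def-explicit): the exponents `k` and the transfer factor on the Cayley family
  obtain ⟨k, hk⟩ := exists_archExplicitDelta_cayleyTorus_relabel_eq_prod L α _ rfl μω hμω
  -- the constants
  set σ0 : ℂ := cT * ∏ v : {w : InfinitePlace L // IsComplex w},
      -((((wallPoint L e₁ e₂ h₁ h₂ v 0 : ℂ) * (wallPoint L e₁ e₂ h₁ h₂ v 2 : ℂ)) ^ (k v)) *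
        (((wallPoint L e₁ e₂ h₁ h₂ v 1 : ℂ) - (wallPoint L e₁ e₂ h₁ h₂ v 0 : ℂ)) * ((wallPoint L e₁ e₂ h₁ h₂ v 1 : ℂ) - (wallPoint L e₁ e₂ h₁ h₂ v 2 : ℂ))) / (wallPoint L e₁ e₂ h₁ h₂ v 1 : ℂ)) with hσ0
  set ηP : ℂ := ∏ v : {w : InfinitePlace L // IsComplex w}, ((archMajoritySign L (Matrix.diagonal α) v : ℤ) : ℂ) with hηP
  set Λ : {w : InfinitePlace L // IsComplex w} → ℂ := fun v => (2 : ℂ) * (1 : ℝ) * ((Finset.univ.filter fun i => 0 < (v.1.embedding (α i)).re).card.factorial *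
      (3 - (Finset.univ.filter fun i => 0 < (v.1.embedding (α i)).re).card).factorial : ℕ) * ∏ i : Fin 3, (((SignType.sign ((v.1.embedding (α i)).re) : ℤ)) : ℂ) with hΛ
  have hσ0ne : σ0 ≠ 0 := by
    refine mul_ne_zero hcT (Finset.prod_ne_zero_iff.2 fun v _ => ?_)
    have h01 : (wallPoint L e₁ e₂ h₁ h₂ v 1 : ℂ) ≠ (wallPoint L e₁ e₂ h₁ h₂ v 0 : ℂ) := fun h => wallPoint_zero_ne_one L e₁ e₂ h₁ h₂ hne v (Circle.ext h).symm
    have h21 : (wallPoint L e₁ e₂ h₁ h₂ v 1 : ℂ) ≠ (wallPoint L e₁ e₂ h₁ h₂ v 2 : ℂ) := fun h =>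
      wallPoint_zero_ne_one L e₁ e₂ h₁ h₂ hne v ((wallPoint_zero_eq_two L e₁ e₂ h₁ h₂ v).trans (Circle.ext h).symm)
    exact neg_ne_zero.2 (div_ne_zero (mul_ne_zero (zpow_ne_zero _ (mul_ne_zero (Circle.coe_ne_zero _) (Circle.coe_ne_zero _)))
      (mul_ne_zero (sub_ne_zero.2 h01) (sub_ne_zero.2 h21))) (Circle.coe_ne_zero _))
  have hηPne : ηP ≠ 0 := Finset.prod_ne_zero_iff.2 fun v _ => Int.cast_ne_zero.2 (archMajoritySign_ne_zero L (Matrix.diagonal α) v)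
  have hΛne : ∀ v, Λ v ≠ 0 := fun v => by
    refine mul_ne_zero (mul_ne_zero (mul_ne_zero two_ne_zero (by norm_num)) (by exact_mod_cast Nat.mul_ne_zero (Nat.factorial_ne_zero _) (Nat.factorial_ne_zero _)))
      (Finset.prod_ne_zero_iff.2 fun i _ => ?_)
    rw [Int.cast_ne_zero]
    rcases (re_embedding_ne_zero L 3 α v hα (hreal v) i).lt_or_gt with h | h
    · rw [sign_neg h]; decide
    · rw [sign_pos h]; decide
  have hNne : ((relabelMultiplicity L α : ℕ) : ℂ) ≠ 0 := Nat.cast_ne_zero.2 (K2E4ArchGPrimeEndAlg.relabelMultiplicity_ne_zero L α)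
  have hχne : ((χ.toReal : ℝ) : ℂ) ≠ 0 := Complex.ofReal_ne_zero.2 (ENNReal.toReal_ne_zero.2 ⟨hχ0, hχ⟩)
  refine ⟨(χ.toReal : ℂ) * ((relabelMultiplicity L α : ℕ) : ℂ)⁻¹ * σ0 * ηP * (r : ℂ) * ∏ v, Λ v,
    mul_ne_zero (mul_ne_zero (mul_ne_zero (mul_ne_zero (mul_ne_zero hχne (inv_ne_zero hNne)) hσ0ne) hηPne) (Complex.ofReal_ne_zero.2 hr.ne')) (Finset.prod_ne_zero_iff.2 fun v _ => hΛne v), ?_, ?_⟩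
  · /- THE PHASE LAW of the explicit end constant: `lam = s · Π_v sgn σ_v(α₀α₂) · T′.Δ(h₀, t)`, `s = χ·N⁻¹·r·Π_v 2·p_v!(3−p_v)! > 0` -/
    have hNpos : 0 < ((relabelMultiplicity L α : ℕ) : ℝ) := Nat.cast_pos.2 (Nat.pos_of_ne_zero (K2E4ArchGPrimeEndAlg.relabelMultiplicity_ne_zero L α))
    have hχpos : 0 < χ.toReal := ENNReal.toReal_pos hχ0 hχ
    refine ⟨χ.toReal * ((relabelMultiplicity L α : ℕ) : ℝ)⁻¹ * r *
        ∏ v : {w : InfinitePlace L // IsComplex w}, (2 : ℝ) * (((Finset.univ.filter fun i => 0 < (v.1.embedding (α i)).re).card.factorial *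
          (3 - (Finset.univ.filter fun i => 0 < (v.1.embedding (α i)).re).card).factorial : ℕ) : ℝ),
      mul_pos (mul_pos (mul_pos hχpos (inv_pos.2 hNpos)) hr)
        (Finset.prod_pos fun v _ => mul_pos two_pos (Nat.cast_pos.2 (Nat.mul_pos (Nat.factorial_pos _) (Nat.factorial_pos _)))), ?_⟩
    -- the assembler's `H_∞`-point at the CENTRAL 2-block datum IS the Cayley point of the wall datum (★ (end-alg) §1 with ★ Lemmas `twoBlock_univ`)
    have hH0 : ((unitaryGroupOfFormCongrOfEq (UnitaryGroup.conjMixed (↥(maximalRealSubfield L)) L (IsCMField.complexConj L))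
                (Matrix.GeneralLinearGroup.map (mixedEmbedding L) (Matrix.GeneralLinearGroup.mkOfDetNeZero !![(1 : L), 1; 1, -1] (UnitaryGroup.det_quasiSplitFrameTwo_ne_zero L)))
                (UnitaryGroup.archFormOf L 2 (Matrix.diagonal ![(2 : L)⁻¹, -(2 : L)⁻¹])) (UnitaryGroup.archFormOf L 2 (Matrix.of fun i j : Fin 2 => if i.val + j.val + 1 = 2 then (1 : L) else 0))
                (UnitaryGroup.formCongr_map_mixedEmbedding_archFormOf_eq L (UnitaryGroup.formCongr_quasiSplitFrameTwo_diagonal L))).symm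
                (UnitaryGroup.archDiagTorus L 2 ![(2 : L)⁻¹, -(2 : L)⁻¹] fun w => ![(⟨w.1.embedding e₁, mem_sphere_zero_iff_norm.mpr (UnitaryGroup.norm_embedding_eq_one_of_complexConj_mul_self L e₁ h₁ w)⟩ : Circle), ⟨w.1.embedding e₁, mem_sphere_zero_iff_norm.mpr (UnitaryGroup.norm_embedding_eq_one_of_complexConj_mul_self L e₁ h₁ w)⟩]),
              (UnitaryGroup.archPiEquivCM 1 L (Matrix.of fun i j : Fin 1 => if i.val + j.val + 1 = 1 then (1 : L) else 0)).symm fun w =>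
                ⟨UnitaryGroup.circleDiagonal 1 ![(⟨w.1.embedding e₂, mem_sphere_zero_iff_norm.mpr (UnitaryGroup.norm_embedding_eq_one_of_complexConj_mul_self L e₂ h₂ w)⟩ : Circle)], UnitaryGroup.circleDiagonal_mem_archLocal_antidiagOne L w _⟩) =
        (fun z : {w : InfinitePlace L // IsComplex w} → Fin 3 → Circle =>
          ((UnitaryGroup.archPiEquivCM 2 L (Matrix.of fun i j : Fin 2 => if i.val + j.val + 1 = 2 then (1 : L) else 0)).symm fun w =>
              ⟨Matrix.GeneralLinearGroup.mkOfDetNeZero !![(1 : ℂ), 1; 1, -1] UnitaryGroup.det_cayleyTwo_ne_zero *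
                  UnitaryGroup.circleDiagonal 2 ![z w 0, z w 2] *
                (Matrix.GeneralLinearGroup.mkOfDetNeZero !![(1 : ℂ), 1; 1, -1] UnitaryGroup.det_cayleyTwo_ne_zero)⁻¹,
                UnitaryGroup.cayley_conj_circleDiagonal_mem_archLocal L w _⟩,
            (UnitaryGroup.archPiEquivCM 1 L (Matrix.of fun i j : Fin 1 => if i.val + j.val + 1 = 1 then (1 : L) else 0)).symm fun w =>
              ⟨UnitaryGroup.circleDiagonal 1 ![z w 1], UnitaryGroup.circleDiagonal_mem_archLocal_antidiagOne L w _⟩))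
          (wallPoint L e₁ e₂ h₁ h₂) := by
      have h := K2E4ArchGPrimeEndAlg.hPoint_univ_eq_cayley L e₁ e₂ h₁ h₂ (fun _ _ => 1)
      rw [K2E4ArchGPrimeLemmas.twoBlock_univ] at h
      exact h
    have hT0 : (UnitaryGroup.archDiagTorus L 3 α fun w => ![(⟨w.1.embedding e₁, mem_sphere_zero_iff_norm.mpr (UnitaryGroup.norm_embedding_eq_one_of_complexConj_mul_self L e₁ h₁ w)⟩ : Circle), ⟨w.1.embedding e₂, mem_sphere_zero_iff_norm.mpr (UnitaryGroup.norm_embedding_eq_one_of_complexConj_mul_self L e₂ h₂ w)⟩, ⟨w.1.embedding e₁, mem_sphere_zero_iff_norm.mpr (UnitaryGroup.norm_embedding_eq_one_of_complexConj_mul_self L e₁ h₁ w)⟩]) = UnitaryGroup.archDiagTorus L 3 α (fun v => wallPoint L e₁ e₂ h₁ h₂ v ∘ ⇑((fun _ : {w : InfinitePlace L // IsComplex w} => (1 : Perm (Fin 3))) v)) := rfl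
    -- ★ G2 at the identity relabelling: `T′.Δ(γ_H(z⁰), t(z⁰)) = (Π_v sgn σ_v α₁ · η_v) · σ0`
    have hTt : T'.Δ ((unitaryGroupOfFormCongrOfEq (UnitaryGroup.conjMixed (↥(maximalRealSubfield L)) L (IsCMField.complexConj L))
                (Matrix.GeneralLinearGroup.map (mixedEmbedding L) (Matrix.GeneralLinearGroup.mkOfDetNeZero !![(1 : L), 1; 1, -1] (UnitaryGroup.det_quasiSplitFrameTwo_ne_zero L)))
                (UnitaryGroup.archFormOf L 2 (Matrix.diagonal ![(2 : L)⁻¹, -(2 : L)⁻¹])) (UnitaryGroup.archFormOf L 2 (Matrix.of fun i j : Fin 2 => if i.val + j.val + 1 = 2 then (1 : L) else 0))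
                (UnitaryGroup.formCongr_map_mixedEmbedding_archFormOf_eq L (UnitaryGroup.formCongr_quasiSplitFrameTwo_diagonal L))).symm
                (UnitaryGroup.archDiagTorus L 2 ![(2 : L)⁻¹, -(2 : L)⁻¹] fun w => ![(⟨w.1.embedding e₁, mem_sphere_zero_iff_norm.mpr (UnitaryGroup.norm_embedding_eq_one_of_complexConj_mul_self L e₁ h₁ w)⟩ : Circle), ⟨w.1.embedding e₁, mem_sphere_zero_iff_norm.mpr (UnitaryGroup.norm_embedding_eq_one_of_complexConj_mul_self L e₁ h₁ w)⟩]),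
              (UnitaryGroup.archPiEquivCM 1 L (Matrix.of fun i j : Fin 1 => if i.val + j.val + 1 = 1 then (1 : L) else 0)).symm fun w =>
                ⟨UnitaryGroup.circleDiagonal 1 ![(⟨w.1.embedding e₂, mem_sphere_zero_iff_norm.mpr (UnitaryGroup.norm_embedding_eq_one_of_complexConj_mul_self L e₂ h₂ w)⟩ : Circle)], UnitaryGroup.circleDiagonal_mem_archLocal_antidiagOne L w _⟩) (UnitaryGroup.archDiagTorus L 3 α fun w => ![(⟨w.1.embedding e₁, mem_sphere_zero_iff_norm.mpr (UnitaryGroup.norm_embedding_eq_one_of_complexConj_mul_self L e₁ h₁ w)⟩ : Circle), ⟨w.1.embedding e₂, mem_sphere_zero_iff_norm.mpr (UnitaryGroup.norm_embedding_eq_one_of_complexConj_mul_self L e₂ h₂ w)⟩, ⟨w.1.embedding e₁, mem_sphere_zero_iff_norm.mpr (UnitaryGroup.norm_embedding_eq_one_of_complexConj_mul_self L e₁ h₁ w)⟩]) =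
        ((∏ v : {w : InfinitePlace L // IsComplex w}, ((SignType.sign ((v.1.embedding (α (((fun _ : {w : InfinitePlace L // IsComplex w} => (1 : Perm (Fin 3))) v).symm 1))).re) : ℤ) *
            archMajoritySign L (Matrix.diagonal α) v) : ℤ) : ℂ) * σ0 := by
      exact (congrArg₂ T'.Δ hH0 hT0).trans (archTransferFactor_cayleyTorus_relabel_eq_sign_mul L α _ μω T' cT hT k hk (wallPoint L e₁ e₂ h₁ h₂) (fun _ => 1))
    -- per place: `η_v · Λ_v = (2·p_v!(3−p_v)!) · sgn σ_v(α₀α₂) · (sgn σ_v α₁ · η_v)` (multiplicativity of the sign on the real line `im σ_v α_i = 0`)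
    have hplace : ∀ v : {w : InfinitePlace L // IsComplex w},
        ((archMajoritySign L (Matrix.diagonal α) v : ℤ) : ℂ) * Λ v =
          ((2 : ℝ) * (((Finset.univ.filter fun i => 0 < (v.1.embedding (α i)).re).card.factorial *
              (3 - (Finset.univ.filter fun i => 0 < (v.1.embedding (α i)).re).card).factorial : ℕ) : ℝ) : ℂ) *
            ((SignType.sign ((v.1.embedding (α 0 * α 2)).re) : ℤ) : ℂ) *
            (((SignType.sign ((v.1.embedding (α (((fun _ : {w : InfinitePlace L // IsComplex w} => (1 : Perm (Fin 3))) v).symm 1))).re) : ℤ) : ℂ) *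
              ((archMajoritySign L (Matrix.diagonal α) v : ℤ) : ℂ)) := by
      intro v
      have hs1 : (((fun _ : {w : InfinitePlace L // IsComplex w} => (1 : Perm (Fin 3))) v).symm 1) = 1 := rfl
      have hre : (v.1.embedding (α 0 * α 2)).re = (v.1.embedding (α 0)).re * (v.1.embedding (α 2)).re := by
        rw [map_mul, Complex.mul_re, hreal v 0, hreal v 2, mul_zero, sub_zero]
      simp only [hΛ, hs1, Fin.prod_univ_three, hre, sign_mul, SignType.coe_mul, Int.cast_mul]
      push_cast
      ring
    have hprods : ηP * ∏ v, Λ v =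
        (∏ v : {w : InfinitePlace L // IsComplex w}, ((2 : ℝ) * (((Finset.univ.filter fun i => 0 < (v.1.embedding (α i)).re).card.factorial *
            (3 - (Finset.univ.filter fun i => 0 < (v.1.embedding (α i)).re).card).factorial : ℕ) : ℝ) : ℂ)) *
          ((∏ w : {w : InfinitePlace L // IsComplex w}, (SignType.sign ((w.1.embedding (α 0 * α 2)).re) : ℤ)) : ℂ) *
          ((∏ v : {w : InfinitePlace L // IsComplex w}, ((SignType.sign ((v.1.embedding (α (((fun _ : {w : InfinitePlace L // IsComplex w} => (1 : Perm (Fin 3))) v).symm 1))).re) : ℤ) *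
            archMajoritySign L (Matrix.diagonal α) v) : ℤ) : ℂ) := by
      rw [hηP, Int.cast_prod, ← Finset.prod_mul_distrib, ← Finset.prod_mul_distrib, ← Finset.prod_mul_distrib]
      exact Finset.prod_congr rfl fun v _ => by rw [hplace v, Int.cast_mul]
    calc (χ.toReal : ℂ) * ((relabelMultiplicity L α : ℕ) : ℂ)⁻¹ * σ0 * ηP * (r : ℂ) * ∏ v, Λ v
        = (χ.toReal : ℂ) * ((relabelMultiplicity L α : ℕ) : ℂ)⁻¹ * (r : ℂ) * (ηP * ∏ v, Λ v) * σ0 := by ring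
      _ = ((χ.toReal * ((relabelMultiplicity L α : ℕ) : ℝ)⁻¹ * r *
            ∏ v : {w : InfinitePlace L // IsComplex w}, (2 : ℝ) * (((Finset.univ.filter fun i => 0 < (v.1.embedding (α i)).re).card.factorial *
              (3 - (Finset.univ.filter fun i => 0 < (v.1.embedding (α i)).re).card).factorial : ℕ) : ℝ) : ℝ) : ℂ) * ((∏ w : {w : InfinitePlace L // IsComplex w}, (SignType.sign ((w.1.embedding (α 0 * α 2)).re) : ℤ)) : ℂ) *
          (((∏ v : {w : InfinitePlace L // IsComplex w}, ((SignType.sign ((v.1.embedding (α (((fun _ : {w : InfinitePlace L // IsComplex w} => (1 : Perm (Fin 3))) v).symm 1))).re) : ℤ) *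
            archMajoritySign L (Matrix.diagonal α) v) : ℤ) : ℂ) * σ0) := by rw [hprods]; push_cast; ring
      _ = _ := congrArg (HMul.hMul (((χ.toReal * ((relabelMultiplicity L α : ℕ) : ℝ)⁻¹ * r *
            ∏ v : {w : InfinitePlace L // IsComplex w}, (2 : ℝ) * (((Finset.univ.filter fun i => 0 < (v.1.embedding (α i)).re).card.factorial *
              (3 - (Finset.univ.filter fun i => 0 < (v.1.embedding (α i)).re).card).factorial : ℕ) : ℝ) : ℝ) : ℂ) * ((∏ w : {w : InfinitePlace L // IsComplex w}, (SignType.sign ((w.1.embedding (α 0 * α 2)).re) : ℤ)) : ℂ))) hTt.symm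
  · intro Θ hΘ hΘc u
    -- the per-`ρ` summand at `S = univ`
    have hterm : ∀ ρ : {w : InfinitePlace L // IsComplex w} → Perm (Fin 3),
        (χ.toReal : ℂ) * ((relabelMultiplicity L α : ℕ) : ℂ)⁻¹ *
          T'.Δ ((unitaryGroupOfFormCongrOfEq (UnitaryGroup.conjMixed (↥(maximalRealSubfield L)) L (IsCMField.complexConj L))
                (Matrix.GeneralLinearGroup.map (mixedEmbedding L) (Matrix.GeneralLinearGroup.mkOfDetNeZero !![(1 : L), 1; 1, -1] (UnitaryGroup.det_quasiSplitFrameTwo_ne_zero L)))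
                (UnitaryGroup.archFormOf L 2 (Matrix.diagonal ![(2 : L)⁻¹, -(2 : L)⁻¹])) (UnitaryGroup.archFormOf L 2 (Matrix.of fun i j : Fin 2 => if i.val + j.val + 1 = 2 then (1 : L) else 0))
                (UnitaryGroup.formCongr_map_mixedEmbedding_archFormOf_eq L (UnitaryGroup.formCongr_quasiSplitFrameTwo_diagonal L))).symm
                (UnitaryGroup.archDiagTorus L 2 ![(2 : L)⁻¹, -(2 : L)⁻¹] (twoBlock L e₁ h₁ Finset.univ u)),
              (UnitaryGroup.archPiEquivCM 1 L (Matrix.of fun i j : Fin 1 => if i.val + j.val + 1 = 1 then (1 : L) else 0)).symm fun w =>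
                ⟨UnitaryGroup.circleDiagonal 1 ![embCircle L e₂ h₂ w], UnitaryGroup.circleDiagonal_mem_archLocal_antidiagOne L w _⟩)
            (UnitaryGroup.archDiagTorus L 3 α fun v => datum L e₁ e₂ h₁ h₂ Finset.univ u v ∘ ⇑(ρ v)) *
          (∏ v ∈ Finset.univ, wallCoef L α v (ρ v)) *
          ∫ o, Θ ((((archPiEquivCM 3 L (Matrix.diagonal α)).symm o : arch (↥(maximalRealSubfield L)) L (IsCMField.complexConj L) 3 (Matrix.diagonal α)) :
              GL (Fin 3) (mixedSpace L)) : Matrix (Fin 3) (Fin 3) (mixedSpace L))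
            ∂(Measure.pi (stateMeasure L α νw hνw e₁ e₂ h₁ h₂ hne νH hνH Finset.univ u ρ)) =
        ((χ.toReal : ℂ) * ((relabelMultiplicity L α : ℕ) : ℂ)⁻¹ * σ0 * ηP * (r : ℂ)) *
          ((∏ v, ((SignType.sign ((v.1.embedding (α ((ρ v).symm 1))).re) : ℤ) : ℂ) * wallCoef L α v (ρ v)) *
            classOrbitalIntegral (Literature.NumberTheory.Weil1964.UnitaryArchTopForm.archSingularTopFormFamily L (Matrix.diagonal α) ν)
              (fun g : arch (↥(maximalRealSubfield L)) L (IsCMField.complexConj L) 3 (Matrix.diagonal α) => Θ ((g : GL (Fin 3) (mixedSpace L)) : Matrix (Fin 3) (Fin 3) (mixedSpace L)))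
              (ConjClasses.mk (archDiagTorus L 3 α fun v => wallPoint L e₁ e₂ h₁ h₂ v ∘ ⇑(ρ v)))) := by
      intro ρ
      rw [K2E4ArchGPrimeLemmas.stateMeasure_univ, hread Θ hΘ hΘc ρ, K2E4ArchGPrimeLemmas.datum_univ, K2E4ArchGPrimeEndAlg.hPoint_univ_eq_cayley,
        archTransferFactor_cayleyTorus_relabel_eq_sign_mul L α _ μω T' cT hT k hk (wallPoint L e₁ e₂ h₁ h₂) ρ]
      rw [Int.cast_prod]
      simp only [Int.cast_mul, Finset.prod_mul_distrib]
      ring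
    -- ★ (E-alg): the κ-signed regrouping with the `(−1)`-pinned coefficients (`cst ≡ −1`, `mass ≡ 1`, `M ≡ 1`)
    have hwt : ∀ (v : {w : InfinitePlace L // IsComplex w}) (σ : Perm (Fin 3)),
        ((SignType.sign ((v.1.embedding (α (σ.symm 1))).re) : ℤ) : ℂ) * wallCoef L α v σ =
          (((SignType.sign ((v.1.embedding (α (σ.symm 1))).re) : ℤ) : ℂ) *
            ((if 0 < (v.1.embedding (α (σ⁻¹ 0))).re * (v.1.embedding (α (σ⁻¹ 2))).re then (2 : ℂ) else (fun _ : Perm (Fin 3) => -((1 : ℝ) : ℂ)) σ) *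
              (((if 0 < (v.1.embedding (α (σ⁻¹ 0))).re * (v.1.embedding (α (σ⁻¹ 2))).re then (fun _ : Perm (Fin 3) => (1 : NNReal)) σ else 1 : NNReal) : ℝ) : ℂ))) := by
      intro v σ
      simp only [wallCoef]
      split_ifs <;> simp
    have hsum := sum_univ_prod_mul_classOrbitalIntegral_mk_archDiagTorus_comp_eq_prod_mul_archStableOrbitalIntegral_of_fibre_const L 3 α hα hherm
      (fun v => wallPoint L e₁ e₂ h₁ h₂ v)
      (fun v σ => ((SignType.sign ((v.1.embedding (α (σ.symm 1))).re) : ℤ) : ℂ) * wallCoef L α v σ) Λ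
      (fun v r' => by
        rw [Finset.sum_congr rfl fun σ _ => hwt v σ]
        exact sum_filter_sign_mul_wallWeight_eq_two_mul_mul_prod_sign L α v hα (hreal v) (wallPoint_zero_eq_two L e₁ e₂ h₁ h₂ v) (wallPoint_zero_ne_one L e₁ e₂ h₁ h₂ hne v)
          (fun _ => -((1 : ℝ) : ℂ)) (fun _ => (1 : NNReal)) (1 : ℝ) (fun _ _ => rfl) (fun _ _ => NNReal.coe_one) r')
      (Literature.NumberTheory.Weil1964.UnitaryArchTopForm.archSingularTopFormFamily L (Matrix.diagonal α) ν)
      (fun g : arch (↥(maximalRealSubfield L)) L (IsCMField.complexConj L) 3 (Matrix.diagonal α) => Θ ((g : GL (Fin 3) (mixedSpace L)) : Matrix (Fin 3) (Fin 3) (mixedSpace L)))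
    unfold gState
    rw [Finset.sum_congr rfl fun ρ _ => hterm ρ, ← Finset.mul_sum, hsum]
    ring

end Frame

end Summit.HodgeConjecture.HodgeConjecture.Cruxes.H413.K2E4ArchGPrimeEndAlgSigned

end
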